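import Summits.RiemannHypothesis.RiemannHypothesis.Theorems.GroundBartaEvenWinsBeyondArchDeflationUpperY
import Summits.RiemannHypothesis.RiemannHypothesis.Theorems.GroundBartaEvenWinsBeyondArchDeflationMarkovY3
import Summits.RiemannHypothesis.RiemannHypothesis.Theorems.GroundBartaEvenWinsBeyondArchDeflationM80PAssembly
import HarnessLib

/-!
# The parity ladder beyond `log 2`: SHARP U-side at `b = 4023/5000` — `ε(4023/5000) ≤ 10⁻¹⁷`

Support file (GroundBarta rung 4 / WeilParity item stmt-RiemannHypothesis-18085, helper), RH-free.  Prover A (g10).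
Rayleigh–Ritz upper bound at the window `4023/5000` from the LANDED A-layer certificate of the even degree-`54` Ritz vector `p80v1`
of the positivity block (`p80v1_T`, width `8e-28`, prover A g9), the exact norm and the sharp Markov bracket
`dt_weilMarkovConstant_sharp3` (width `3.4e-21`): `ε(4023/5000) ≤ 9.7404e-18 ≤ 10⁻¹⁷` (`dt_groundEnergy_le_of_T`).  It is the
U-side of the ENDPOINT CELL `[4023/5000, (log 5)/2]` of the parity ladder, whose L-side must be an odd-sector lower bound
`10⁻¹⁷ < L ≤ ε_od((log 5)/2)` (`ε_od` there `≈ 1.06e-14`).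
-/

set_option linter.dupNamespace false

noncomputable section

namespace Summit.RiemannHypothesis.RiemannHypothesis.Theorems.EvenWinsBeyondArch

open Literature.NumberTheory.LFunctions Literature.Analysis.ValidatedNumerics.ExpPoly
open Literature.Analysis.ValidatedNumerics.PolyMP Summit.RiemannHypothesis.RiemannHypothesis.Theorems.EvenWinsBeyondArch.ArchM80P

/-- **`ε(4023/5000) ≤ 10⁻¹⁷`** (sharp U-side at `4023/5000`, even degree-54 Ritz vector, sharp Markov bracket). [folklore] -/
theorem trialUpper80sharp : weilGroundEnergy (4023 / 5000 : ℝ) ≤ (1 / 100000000000000000 : ℝ) := by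
  have hT := p80v1_T
  have h2 := m80_log2_lt
  have h5 := m80_le_log5
  push_cast at h2 h5
  have hM := dt_weilMarkovConstant_sharp3 h2 h5
  have h := dt_groundEnergy_le_of_T p80v1P p80v1E (b := 4023 / 5000) (by norm_num) p80v1_hE
    (Thi := 280501641072217936104638540556268449097905124157473286344829582755394640323380505897326887594480275147084819301089958922881220713820376780376430092757900106386954102903/33737833306056003448973713552267341209859579124438204222072016015971900580859740160000000000000000000000000000000000000000000000000000000000000000000000000000000000000)
    (Mlo := 83141569444492860377359 / 10000000000000000000000)
    (by push_cast at hT ⊢; exact hT.2) (by push_cast at hM ⊢; exact hM.1) (by rw [m80PIQ_0_0]; norm_num)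
  rw [m80PIQ_0_0] at h
  push_cast at h
  refine le_trans h ?_
  norm_num

end Summit.RiemannHypothesis.RiemannHypothesis.Theorems.EvenWinsBeyondArch

end
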